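import Literature.Computability.Complexity.Oracle
import HarnessLib

/-!
# Oracle computations as query/answer trees, and their transcript step functions

Trunk `CplxCore` (Literature/Computability/Complexity), companion of `Oracle.lean` (G01,
`OracleAlg`: oracle algorithms presented by a *step function* `(input, answers so far) ↦ next
query or output`). Writing a concrete oracle algorithm directly as a step function means
replaying the whole computation from the transcript at every step; this file provides the
standard bridge from the *sequential* description of an oracle computation to `OracleAlg`:

* `OracleComp β` — an oracle computation with results in `β`, i.e. a well-founded
  query/answer tree: either a result `pure b`, or a query `q` together with a continuation for
  every possible answer (`query q k`). This is the free monad on one operation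
  `ask : List Bool → List Bool` (a `Monad` instance is provided, so computations can be written
  in `do`-notation), i.e. the "oracle Turing machine as an interactive protocol with the
  oracle" of Arora–Barak, Def. 3.4 (the machine writes a query, enters `q_query`, and continues
  from the answer), stripped of the machine.
* `OracleComp.eval O c` — the result of `c` when every query is answered by the oracle `O`;
  `OracleComp.queryCount O c` — the number of queries asked on that path.
* `OracleComp.toStep c answers` — the transcript step function: follow the answers received so
  far down the tree and report the next query or the output; `OracleComp.toOracleAlg` bundles
  it into an `OracleAlg`, and `OracleComp.run_toOracleAlg` proves that G01's fuelled runner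
  `OracleAlg.run` (which appends `O q` to the transcript at each query) returns `eval O (c x)`
  as soon as the fuel exceeds `queryCount O (c x)`.
* Combinators with their `eval`/`queryCount` laws: `ask`, `bind` (`eval_bind`,
  `queryCount_bind`), `forEach` (a `mapM` with a transparent definition), `iterM` (bounded
  loops), `firstM` (first success in a list, `List.findSome?`).

Design notes. `OracleComp` is an ordinary inductive type (the continuation `List Bool → _` is a
strictly positive occurrence), and `eval`, `queryCount`, `toStep`, `bind` are structural
recursions through the continuation. Everything is stated for G01's `Oracle = List Bool →
List Bool` and `OracleAlg.run`; no complexity is involved (polynomial time of the resulting step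
function is a separate matter, `OracleAlg.IsPolyTime`).

## References

* S. Arora, B. Barak, *Computational Complexity: A Modern Approach*, CUP 2009, §3.4, Def. 3.4
  (oracle Turing machines: query tape, query state, the answer determines the next
  configuration), and §17.2 (`FP^O`).
* T. Baker, J. Gill, R. Solovay, *Relativizations of the P =? NP question*, SIAM J. Comput. 4
  (1975), §1 (query machines).
-/

namespace Literature.Computability.Complexity

open _root_.Computability

/-- An **oracle computation** with results in `β`: a well-founded tree whose leaves are results
(`pure b`) and whose internal nodes ask a query `q : List Bool` and continue with `k a` on
answer `a` (`query q k`). The free monad on the query operation; the machine-free content of an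
oracle Turing machine computation. [Arora–Barak 2009, §3.4, Def. 3.4] [cite: AroraBarak2009, §3.4 Def. 3.4] -/
inductive OracleComp (β : Type) : Type
  /-- Return the result `b` without (further) queries. -/
  | pure : β → OracleComp β
  /-- Ask the query `q`; on answer `a` continue with `k a`. -/
  | query : List Bool → (List Bool → OracleComp β) → OracleComp β

namespace OracleComp

variable {α β γ σ : Type}

/-- Sequential composition: run `c`, then `f` on its result (grafting trees).
[Arora–Barak 2009, §3.4] [folklore] -/
protected def bind : OracleComp β → (β → OracleComp γ) → OracleComp γ
  | pure b, f => f b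
  | query q k, f => query q fun a => OracleComp.bind (k a) f

/-- `OracleComp` is a monad (`pure`, `bind`), so computations can be written in `do`-notation.
[folklore] -/
instance : Monad OracleComp where
  pure := OracleComp.pure
  bind := OracleComp.bind

/-- The single query `q`, returning the oracle's answer. [Arora–Barak 2009, §3.4, Def. 3.4
(the query state)] [cite: AroraBarak2009, §3.4 Def. 3.4] -/
def ask (q : List Bool) : OracleComp (List Bool) :=
  query q pure

/-- The result of the computation when every query is answered by the oracle `O`.
[Arora–Barak 2009, §3.4, Def. 3.4 (`M^O(x)`)] [cite: AroraBarak2009, §3.4 Def. 3.4] -/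
def eval (O : Oracle) : OracleComp β → β
  | pure b => b
  | query q k => eval O (k (O q))

/-- The number of queries asked when every query is answered by `O`. [Arora–Barak 2009, §3.4] [cite: AroraBarak2009, §3.4] -/
def queryCount (O : Oracle) : OracleComp β → ℕ
  | pure _ => 0
  | query q k => queryCount O (k (O q)) + 1

/-- The queries asked, in order, when every query is answered by `O`. [Arora–Barak 2009, §3.4] [cite: AroraBarak2009, §3.4] -/
def queryList (O : Oracle) : OracleComp β → List (List Bool)
  | pure _ => []
  | query q k => q :: queryList O (k (O q))

/-- **The transcript step function** of a computation: follow the answers received so far down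
the tree; report the next query (`Sum.inl q`) or the output (`Sum.inr b`). Surplus answers after
an output are ignored. [Arora–Barak 2009, §3.4 (configurations of an oracle TM are determined
by the input and the answers)] [cite: AroraBarak2009, §3.4] -/
def toStep : OracleComp β → List (List Bool) → List Bool ⊕ β
  | pure b, _ => Sum.inr b
  | query q _, [] => Sum.inl q
  | query _ k, a :: answers => toStep (k a) answers

/-- The oracle algorithm (G01 `OracleAlg`, a step function) of an input-indexed family of oracle
computations. [Arora–Barak 2009, §3.4, Def. 3.4] [cite: AroraBarak2009, §3.4 Def. 3.4] -/
def toOracleAlg (c : List Bool → OracleComp β) : OracleAlg β where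
  step x answers := toStep (c x) answers

/-! ### Laws of `eval` and `queryCount` -/

/-- The monad's `pure` is the constructor `pure` (normal form for `simp`). [folklore] -/
@[simp] theorem pure_eq_pure (b : β) : (Pure.pure b : OracleComp β) = pure b := rfl

/-- The monad's `>>=` is `OracleComp.bind` (normal form for `simp`). [folklore] -/
@[simp] theorem bind_eq_bind (c : OracleComp β) (f : β → OracleComp γ) :
    c >>= f = OracleComp.bind c f := rfl

/-- `eval` of a leaf. [folklore] -/
@[simp] theorem eval_pure (O : Oracle) (b : β) : eval O (pure b) = b := rfl

/-- `eval` of a query node. [folklore] -/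
@[simp] theorem eval_query (O : Oracle) (q : List Bool) (k : List Bool → OracleComp β) :
    eval O (query q k) = eval O (k (O q)) := rfl

/-- `eval` of a single query is the oracle's answer. [Arora–Barak 2009, §3.4] [cite: AroraBarak2009, §3.4] -/
@[simp] theorem eval_ask (O : Oracle) (q : List Bool) : eval O (ask q) = O q := rfl

/-- No query at a leaf. [folklore] -/
@[simp] theorem queryCount_pure (O : Oracle) (b : β) : queryCount O (pure b) = 0 := rfl

/-- One query at a query node, plus those of the continuation taken. [folklore] -/
@[simp] theorem queryCount_query (O : Oracle) (q : List Bool) (k : List Bool → OracleComp β) :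
    queryCount O (query q k) = queryCount O (k (O q)) + 1 := rfl

/-- A single query asks one query. [folklore] -/
@[simp] theorem queryCount_ask (O : Oracle) (q : List Bool) : queryCount O (ask q) = 1 := rfl

/-- **`eval` is a monad morphism**: `eval O (c >>= f) = eval O (f (eval O c))`.
[folklore] -/
@[simp] theorem eval_bind (O : Oracle) (c : OracleComp β) (f : β → OracleComp γ) :
    eval O (OracleComp.bind c f) = eval O (f (eval O c)) := by
  induction c with
  | pure b => rfl
  | query q k ih => exact ih (O q)

/-- Queries of a sequential composition add up along the path taken. [folklore] -/
@[simp] theorem queryCount_bind (O : Oracle) (c : OracleComp β) (f : β → OracleComp γ) :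
    queryCount O (OracleComp.bind c f) = queryCount O c + queryCount O (f (eval O c)) := by
  induction c with
  | pure b => simp [OracleComp.bind, queryCount, eval]
  | query q k ih =>
    simp only [OracleComp.bind, queryCount, eval]
    rw [ih (O q)]
    omega

/-- The query list has length `queryCount`. [folklore] -/
theorem length_queryList (O : Oracle) (c : OracleComp β) :
    (queryList O c).length = queryCount O c := by
  induction c with
  | pure b => rfl
  | query q k ih => simp [queryList, queryCount, ih (O q)]

/-! ### The runner computes `eval` -/

/-- Feeding the answers of `O` to the first `j` queries lands at the subtree reached after `j`
queries; in particular the step function reports the right next query / output. Formally: if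
the step function of `M` on input `x` extends `toStep c` after the prefix `pre` of answers, then
`M.runAux O x n pre = some (eval O c)` for any fuel `n > queryCount O c`.
[Arora–Barak 2009, §3.4] [cite: AroraBarak2009, §3.4] -/
theorem runAux_eq_of_toStep (M : OracleAlg β) (O : Oracle) (x : List Bool) :
    ∀ (c : OracleComp β) (pre : List (List Bool)),
      (∀ answers, M.step x (pre ++ answers) = toStep c answers) →
        ∀ n, queryCount O c < n → M.runAux O x n pre = some (eval O c)
  | pure b, pre, hstep, n + 1, _ => by
    rw [OracleAlg.runAux_succ, show M.step x pre = Sum.inr b by simpa [toStep] using hstep []]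
    rfl
  | query q k, pre, hstep, n + 1, hn => by
    rw [OracleAlg.runAux_succ, show M.step x pre = Sum.inl q by simpa [toStep] using hstep []]
    simp only [queryCount] at hn
    refine runAux_eq_of_toStep M O x (k (O q)) (pre ++ [O q]) (fun answers => ?_) n (by omega)
    rw [List.append_assoc, hstep]
    rfl

/-- **The fuelled runner returns `eval`.** For fuel exceeding the number of queries,
`(toOracleAlg c).run O n x = some (eval O (c x))`. [Arora–Barak 2009, §3.4, Def. 3.4]
[cite: AroraBarak2009, §3.4 Def. 3.4] -/
theorem run_toOracleAlg (c : List Bool → OracleComp β) (O : Oracle) (x : List Bool) {n : ℕ}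
    (hn : queryCount O (c x) < n) : (toOracleAlg c).run O n x = some (eval O (c x)) :=
  runAux_eq_of_toStep (toOracleAlg c) O x (c x) [] (fun _ => rfl) n hn

/-- The transcript of the run is the query list (for fuel exceeding the number of queries the
transcript is complete). Auxiliary form. [Arora–Barak 2009, §3.4] [cite: AroraBarak2009, §3.4] -/
theorem queriesAux_eq_of_toStep (M : OracleAlg β) (O : Oracle) (x : List Bool) :
    ∀ (c : OracleComp β) (pre : List (List Bool)),
      (∀ answers, M.step x (pre ++ answers) = toStep c answers) →
        ∀ n, queryCount O c < n → M.queriesAux O x n pre = queryList O c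
  | pure b, pre, hstep, n + 1, _ => by
    simp only [OracleAlg.queriesAux, show M.step x pre = Sum.inr b by simpa [toStep] using hstep []]
    rfl
  | query q k, pre, hstep, n + 1, hn => by
    simp only [OracleAlg.queriesAux,
      show M.step x pre = Sum.inl q by simpa [toStep] using hstep [], queryList]
    simp only [queryCount] at hn
    rw [queriesAux_eq_of_toStep M O x (k (O q)) (pre ++ [O q]) (fun answers => ?_) n (by omega)]
    rw [List.append_assoc, hstep]
    rfl

/-- The queries asked by the run of `toOracleAlg c` are `queryList O (c x)` (fuel exceeding the
number of queries). [Arora–Barak 2009, §3.4] [cite: AroraBarak2009, §3.4] -/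
theorem queries_toOracleAlg (c : List Bool → OracleComp β) (O : Oracle) (x : List Bool) {n : ℕ}
    (hn : queryCount O (c x) < n) : (toOracleAlg c).queries O n x = queryList O (c x) :=
  queriesAux_eq_of_toStep (toOracleAlg c) O x (c x) [] (fun _ => rfl) n hn

/-! ### Combinators -/

/-- Run `f` on each element of a list in order, collecting the results (a `mapM` with a
transparent recursion). [folklore] -/
def forEach (f : α → OracleComp β) : List α → OracleComp (List β)
  | [] => pure []
  | a :: l => OracleComp.bind (f a) fun b => OracleComp.bind (forEach f l) fun bs => pure (b :: bs)

/-- `eval` of `forEach` is `List.map` of the evaluations. [folklore] -/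
@[simp] theorem eval_forEach (O : Oracle) (f : α → OracleComp β) (l : List α) :
    eval O (forEach f l) = l.map fun a => eval O (f a) := by
  induction l with
  | nil => rfl
  | cons a l ih => simp [forEach, ih]

/-- Queries of `forEach` add up. [folklore] -/
theorem queryCount_forEach (O : Oracle) (f : α → OracleComp β) (l : List α) :
    queryCount O (forEach f l) = (l.map fun a => queryCount O (f a)).sum := by
  induction l with
  | nil => rfl
  | cons a l ih => simp [forEach, ih]

/-- Queries of `forEach` under a uniform bound. [folklore] -/
theorem queryCount_forEach_le (O : Oracle) (f : α → OracleComp β) (l : List α) {B : ℕ}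
    (hB : ∀ a ∈ l, queryCount O (f a) ≤ B) : queryCount O (forEach f l) ≤ l.length * B := by
  rw [queryCount_forEach]
  induction l with
  | nil => simp
  | cons a l ih =>
    simp only [List.map_cons, List.sum_cons, List.length_cons, Nat.succ_mul]
    have h1 := hB a (by simp)
    have h2 := ih fun a' ha' => hB a' (by simp [ha'])
    omega

/-- Bounded loop: iterate the state transformer `f` `n` times. [folklore] -/
def iterM (f : σ → OracleComp σ) : ℕ → σ → OracleComp σ
  | 0, s => pure s
  | n + 1, s => OracleComp.bind (f s) fun s' => iterM f n s'

/-- `eval` of a bounded loop is the iterate of the evaluated body. [folklore] -/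
@[simp] theorem eval_iterM (O : Oracle) (f : σ → OracleComp σ) (n : ℕ) (s : σ) :
    eval O (iterM f n s) = (fun s => eval O (f s))^[n] s := by
  induction n generalizing s with
  | zero => rfl
  | succ n ih => simp [iterM, ih, Function.iterate_succ_apply]

/-- Queries of a bounded loop under a uniform bound on the body. [folklore] -/
theorem queryCount_iterM_le (O : Oracle) (f : σ → OracleComp σ) {B : ℕ}
    (hB : ∀ s, queryCount O (f s) ≤ B) (n : ℕ) (s : σ) : queryCount O (iterM f n s) ≤ n * B := by
  induction n generalizing s with
  | zero => simp [iterM]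
  | succ n ih =>
    simp only [iterM, queryCount_bind, Nat.succ_mul]
    have := hB s
    have := ih (eval O (f s))
    omega

/-- First success: run `f` on the elements of `l` in order until some run returns `some`.
[folklore] -/
def firstM (f : α → OracleComp (Option β)) : List α → OracleComp (Option β)
  | [] => pure none
  | a :: l => OracleComp.bind (f a) fun r =>
      match r with
      | some b => pure (some b)
      | none => firstM f l

/-- `eval` of `firstM` is `List.findSome?` of the evaluations. [folklore] -/
@[simp] theorem eval_firstM (O : Oracle) (f : α → OracleComp (Option β)) (l : List α) :
    eval O (firstM f l) = l.findSome? fun a => eval O (f a) := by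
  induction l with
  | nil => rfl
  | cons a l ih =>
    simp only [firstM, eval_bind, List.findSome?_cons]
    cases eval O (f a) with
    | some b => rfl
    | none => exact ih

/-- Queries of `firstM` under a uniform bound. [folklore] -/
theorem queryCount_firstM_le (O : Oracle) (f : α → OracleComp (Option β)) (l : List α) {B : ℕ}
    (hB : ∀ a ∈ l, queryCount O (f a) ≤ B) : queryCount O (firstM f l) ≤ l.length * B := by
  induction l with
  | nil => simp [firstM]
  | cons a l ih =>
    simp only [firstM, queryCount_bind, List.length_cons, Nat.succ_mul]
    have h1 := hB a (by simp)
    have h2 := ih fun a' ha' => hB a' (by simp [ha'])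
    cases eval O (f a) with
    | some b => simp; omega
    | none => simp only []; omega

end OracleComp

end Literature.Computability.Complexity
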